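import Mathlib
import HarnessLib
import HarnessLib.Audit
import Summits.Parity.Statement
import Literature.NumberTheory.Sieve.SieveFrameworkFundamentalLemma

/-!
Route: HullDescent

CLOSED (retired) 2026-08-15T13:49:44Z by operator:999:1257524 — reason: not-a-thesis: assembly does not conclude the sub-problem Statement — note: D-0027 §2.1 audit (human 2026-08-15: routes that do not decide the summit are removed): the assembly concludes `PolignacInHullClass`, not the sub-problem statement; a NEW conforming route may be opened from the same idea (generated `closes : … → _root_.GeneralizedHardyLittlewood`).. The file is kept as the record of this route; refuted decls are indexed as negative knowledge (`ledger negatives`).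

# Route HullDescent — twin-type primes from level 1/2+δ for pairs of {1 mod 16}-composed numbers,
via a tilted sub-half-dimensional Rosser sieve (hull descent at degree 8)

REDUCTION ROUTE, declared up front (like route TargetGraphParity): the Assembly concludes in the
Target `PolignacInHullClass` — for every h ≠ 0 with 16 ∣ h and no prime factor ≡ 1 (mod 16), there
are infinitely many primes p ≡ 1 (mod 16) with p + h prime (de Polignac's conjecture for the gaps
16, 32, 48, …, an infinite-complexity corollary of GHL at d = 1, t = 2) — and NOT in
Summit.Parity.GeneralizedHardyLittlewood; no X → GHL is claimed. It realises card
quartic-hull-descent with the refuter-requested repair (tilted density, degree dial made explicit).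
Setting: the HULL N₁₆ = {n ≥ 1 : p ∣ n ⇒ p ≡ 1 (mod 16)} (integers composed of the primes splitting
completely in ℚ(ζ₁₆), Dirichlet density 1/8; #N₁₆ ∩ [1, y] ~ c·y(log y)^{−7/8}); for admissible h,
X_h(x) = #{n ≤ x : n, n+h ∈ N₁₆}, A_d(x) = #{n ≤ x : n, n+h ∈ N₁₆, d ∣ n(n+h)}; the TILT T_x(e) = (1
− log e/log x)^{−7/8} and the tilted, non-multiplicative model density G_x(d) = (c(d)/d)·Σ_{ef=d}
T_x(e)T_x(f) on squarefree d composed of split primes (c(d) = Π_{p∣d}(1+η_p), |η_p| ≤ C/p free), G_x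
= 0 otherwise. It suffices to show X = HullPairsLevel ∧ TiltedSieveMainTerm ∧ HullPairMass: (HPL)
for some θ > 1/2, δ > 0: Σ_{d ∣ P(√x), d ≤ x^θ} |A_d(x) − G_x(d)X_h(x)| ≤ X_h(x)(log x)^{−1/4−δ}
eventually; (TSMT) for θ ∈ (1/2, 3/5]: Σ_{d ∣ P(√x)} μ(d)χ⁻_{x^θ}(d)G_x(d) ≥ c(θ)(log x)^{−1/4}, χ⁻
= Rosser's lower truncation with β = 1 (tree: BetaSieve.ind 0 1); (HPM) X_h(x) ≥ x/(log x)²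
eventually. Then Rosser's inequality Σ μχ⁻A_d ≤ S (tree: SieveSequence.lowerSum_le_sifted, PROVED)
and "survivors of sifting hull pairs by all primes < √x are prime pairs + O_h(1)" give #{p ≤ x : p ≡
1 (16), p, p+h prime} ≫ x(log x)^{−9/4} → ∞.
Lean: `HullPairsLevel ∧ TiltedSieveMainTerm ∧ HullPairMass`

## Assembly
Bookkeeping, checked to typecheck in the planner's Sketch.lean (rc 0). Fix admissible h.
HullPairsLevel gives θ₀ ∈ (1/2,1), δ, C, η; put θ = min(θ₀, 3/5) (the remainder sum over d ≤ x^θ is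
a sub-sum). TiltedSieveMainTerm(θ, C, η) gives c > 0; RosserToPrimePairs(h, θ) gives C'. For large
x, since χ⁻_{1,x^θ}(d) = 1 forces d < x^θ (tree BetaSieve.pred: p₁⋯p_m·p_m < D at even m, and d = p
< √x ≤ x^θ at m = 1) and A_d = G_x(d) = 0 off squarefree split-composed d: #{p ≤ x : p ≡ 1 (16), p,
p+h prime} + C' ≥ Σ_d μχ⁻A_d = X_h·Σ_d μχ⁻G_x(d) + Σ_d μχ⁻(A_d − G_xX_h) ≥ X_h(c − (log x)^{−δ})(log
x)^{−1/4} ≥ (c/2)·x(log x)^{−9/4} by HullPairMass; the right side → ∞, so the prime-pair count is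
unbounded, which is PolignacInHullClass. The conclusion is the Target, not the summit (reduction
route).

Rationale: WHY THIS LINE. Card quartic-hull-descent observed that prime pairs are exactly what survives when
PAIRS of hull numbers are sifted by the split primes below √x, so that twin-type primes follow from
a level-of-distribution statement about a multiplicative pair-set in which no prime and no Liouville
function appears; refuter triage (2026-08-15) showed the residual sieve is not half-dimensional
because hull density tilts under divisibility, A_p/X ≈ (2/p)(1 − log p/log x)^{−(1−δ)} (δ =
Dirichlet density of the split primes), giving local dimension 2δ(1−u)^{−(1−δ)} ∈ [0.5, 0.84] at
degree 4 and a threshold θ_c ≈ 0.85. This route's planning analysis adds the a/d LAW: thinning by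
a^{Ω} and raising the degree enter only through δ = a/d, the supremum of the tilted local dimension
over all Buchstab states reachable with d < x^θ (θ ≤ 0.7) is 2δ·2^{1−δ}, and this is < 1/2 first at
δ = 1/8 (values 0.841, 0.696, 0.594, 0.518, 0.458 for d = 4,…,8): at degree 8 (p ≡ 1 mod 16, plain
indicator, no weights) the one-sided condition Ω(1/2) holds in every state, Iwaniec's β = 1 regime
applies (β_{1/2} = 1, tree `iwaniecSiftingLimit_half`; f_{1/2}(1.1) = 0.447, f_{1/2}(1.2) = 0.596
from s^{1/2}f = (e^γ/π)^{1/2}∫₁^s dt/√(t(t−1)), IwaniecActaArith1980, doi:10.4064/aa-29-1-69-95) and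
"a half-step beyond 1/2" is restored honestly. Imported: the Rosser–Iwaniec β-sieve (tree:
BetaSieve.pred/ind, lowerSum_le_sifted, half_dimensional_sieve_lower_holds — the last NOT applicable
verbatim because G_x is x-dependent and non-multiplicative, whence crux TiltedSieveMainTerm),
Wirsing/Selberg–Delange means of frobenian multiplicative functions (Tenenbaum2015 II.5) for the
tilt exponent 7/8, and the vector-sieve viewpoint (Brüdern–Fouvry, Greaves2001 pp. 229–230) for the
two-colour structure of G_x. What no prior route does:
MobiusShiftedPrimes/ShiftedMultiplicationTable take EH for PRIMES (level 1) plus a parity atom; here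
the hypothesis is level 1/2+δ for a DIFFERENT, denser, multiplicatively closed sequence, and
Bombieri's theorem (EH for primes gives no twin primes) is contrasted with "level 1/2+δ for hull
pairs gives Polignac(16k)"; the Selberg ghost b(1−λ(n)λ(n+h)) is excluded exactly by HPL's margin,
since λ has relative bias ≍ (log x)^{−1/4} on N₁₆ (Π_split(1+p^{−s})^{−1} ~ C(s−1)^{1/8}, 1/Γ(−1/8)
≠ 0) — the parity bit is relocated into the (log x)^{−δ} precision of HPL and into HPM, not removed.

RANKED CRUXES. #0 PolignacInHullClass (target) — for every h ≠ 0 with 16 ∣ h and no prime factor ≡ 1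
(mod 16) there are infinitely many primes p ≡ 1 (mod 16) such that p + h is prime (de Polignac for
the gaps 16k, k free of primes ≡ 1 mod 16; the conclusion of the Assembly, implied by but not
implying GHL). (why it might fail: it is an instance of the prime-pair conjecture (infinite
complexity); every known method meets the parity barrier; here it inherits HullPairsLevel and
HullPairMass.) [Polymath8b2014, Bombieri1976, ZhangAnnals2014, Maynard2015]
#2 HullPairsLevel (crux) — (card C2, repaired) LEVEL 1/2+δ FOR HULL PAIRS WITH THE TILTED MODEL. For
every admissible h there are θ ∈ (1/2, 1), δ > 0 and local factors η (|η_p| ≤ C/p, |η_p| ≤ 1/2) such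
that eventually Σ_{d ∣ P(√x), d ≤ x^θ} |A_d(x) − G_x(d)·X_h(x)| ≤ X_h(x)·(log x)^{−1/4−δ}, where
A_d(x) = #{n ≤ x : d ∣ n(n+h), n, n+h ∈ N₁₆}, X_h = A_1, G_x(d) = 1[d squarefree, all p ∣ d ≡ 1
(16)]·(Π_{p∣d}(1+η_p)/d)·Σ_{e∣d} T_x(e)T_x(d/e), T_x(e) = (1 − log e/log x)^{−7/8}. (V(√x) ≍ (log
x)^{−1/4}, so this is Iwaniec's R(𝒜, x^θ) ≤ XV(log x)^{−δ} with the correct x-dependent main terms;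
leading-order model error is O(log log x/log x) ≪ (log x)^{−1/4}, checked.) [difficulty:
open-problem] (why it might fail: Absolute level > 1/2 for a binary (hull-pair) sequence is EH-type
(LargeSieveLevelHalf); even the d ≤ (log x)^A part needs hull pairs equidistributed to (log
x)^{-1/4-δ}, an open binary problem; an unmodelled secondary term of relative size ≥ (log x)^{-1/4}
in A_d/X_h falsifies G as typed.) [BombieriFriedlanderIwaniecActa1986, ZhangAnnals2014,
Polymath8a2014, arXiv:1701.04092, arXiv:1904.12845, Literature.Barriers.Parity.LargeSieveLevelHalf]
#3 TiltedSieveMainTerm (crux) — (card C4's sieve step, made honest) THE β = 1 ROSSER LOWER SIEVE HAS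
A POSITIVE MAIN TERM FOR THE TILTED TWO-COLOUR DENSITY at level x^θ, sifting range √x, for every θ ∈
(1/2, 3/5] and every admissible local-factor perturbation η: Σ_{d ∣ P(√x)} μ(d)·χ⁻_{β=1,
D=x^θ}(d)·G_x(d) ≥ c(θ, C, η)·(log x)^{−1/4} eventually (χ⁻ = tree `BetaSieve.ind 0 1 (x^θ)`; G_x as
in HullPairsLevel; s = 2θ ∈ (1, 6/5]). Expected route: re-run Iwaniec 1980 §§4, 8–9 (tree
RosserSieveSums, RosserSieveMainTerm) with the state-dependent density (1/8)[(1−u/(1−U₁))^{−7/8} +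
(1−u/(1−U₂))^{−7/8}], whose supremum over reachable states is 0.458 < 1/2 for θ ≤ 0.7, so the
one-sided Ω(1/2, L) comparison of Lemma 21 applies state by state and the main term is ≥
V(√x)(f_{1/2}(2θ) − o(1)), f_{1/2}(1.1) = 0.447. [difficulty: L] (why it might fail: G_x is
non-multiplicative (T(e)T(f) couples the prime factors of d through colour sums); if the
state-dependent Buchstab recursion has sifting limit > 1 despite local dimension ≤ 0.458, the β=1
main term is ≤ 0 at s = 2θ ≤ 6/5 and no θ < 1 near 1/2 works.) [IwaniecActaArith1980,
doi:10.4064/aa-29-1-69-95, Greaves2001, FriedlanderIwaniecOpera2010, HalberstamRichert1974,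
Literature.NumberTheory.Sieve.SieveSequence.half_dimensional_sieve_lower_holds]
#4 HullPairMass (crux) — (card C1, weak form) HULL TWINS HAVE AT LEAST MASS x/(log x)²: for every
admissible h, eventually #{n ≤ x : n, n+h ∈ N₁₆} ≥ x/(log x)² (conjectured truth 𝔖_N(h)c²x(log
x)^{−7/4}; any bound ≫ x(log x)^{−2} suffices for the Assembly, the HL-order lower bound x/log²x for
prime pairs needs the true order). [difficulty: open-problem] (why it might fail: Open binary lower
bound: sifting n(n+h) by the non-split primes (density 7/8, κ = 7/4) at s = 2 is below the sifting
limit β_{7/4} ≈ 4; the B-twin analogue (κ = 1, s = 2 = β_1) needed the r(n)-structure of sums of two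
squares (Indlekofer 1974).) [doi:10.4064/aa-26-2-207-212, doi:10.1007/bf01304878, Tenenbaum2015,
Greaves2001, arXiv:1701.04092]
#9 RosserToPrimePairs (support) — ROSSER'S INEQUALITY + SURVIVORS ARE PRIME PAIRS (provable now):
for admissible h, θ ∈ (1/2, 1) there is C = C(h) with, for all x ≥ 2, Σ_{d ∣ P(√x)}
μ(d)χ⁻_{1,x^θ}(d)A_d(x) ≤ #{p ≤ x : p prime, p ≡ 1 (16), p+h prime} + C. Proof: tree
`SieveSequence.lowerSum_le_sifted` (applied to a_m = #{n ≤ x : n(n+h) = m, n, n+h ∈ N₁₆}) bounds the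
left side by the survivors S = #{n ≤ x : n, n+h ∈ N₁₆, (n(n+h), P(√x)) = 1}; a hull number ≤ x free
of primes < √x is 1, a prime ≥ √x, or x = p² itself; n+h ≤ x+h free of primes < √x is prime unless n
> x − h; so S ≤ #{prime pairs} + h + 3. [difficulty: provable-now] [Greaves2001,
IwaniecActaArith1980, Literature.NumberTheory.Sieve.SieveSequence.lowerSum_le_sifted]

TWO-LAYER PLAN. Foreseen glued splits (filed only after a crux closes): TiltedSieveMainTerm ⇐
ContinuousTiltedRecursion (the delay-integral system for f̃(s; U₁, U₂) with the state-dependent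
density, f̃(s;0,0) > 0 for s ∈ (1, 6/5]) → DiscreteComparison (partial summation under one-sided
Ω(1/2, L) per state, Iwaniec Lemmas 20–21) → TiltedSieveMainTerm. HullPairsLevel ⇐ HullPairsSW (hull
pairs in a fixed class mod d with relative error (log x)^{−A}: the Siegel–Walfisz analogue, itself
binary) → HullPairsBV (θ < 1/2 from HullPairsSW by the large sieve) → HullPairsBeyondHalf (the
increment (1/2, 1/2+δ] for Rosser-factorable moduli by dispersion, Zhang/BFI-type) → HullPairsLevel.
HullPairMass ⇐ a single structural child (norm-form families a⁸+b⁸ ∈ N₁₆, or a GL(8)×GL(8)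
shifted-convolution lower bound) if one is found.

KILL CRITERIA. TiltedSieveMainTerm refuted on all of (1/2, 3/5] (sifting limit of the tilted
recursion > 6/5) ⇒ the degree-8 mechanism is dead; one pivot allowed: restate both analytic decls at
δ = 1/16 (p ≡ 1 mod 32, tilt exponent 15/16, sup dimension 0.24) with new decl names; refuted for
every δ > 0 ⇒ `close --reason refuted:TiltedSieveMainTerm`. HullPairsLevel refuted as typed by a
secondary main term (relative size ≥ (log x)^{−1/4} in A_d/X_h) ⇒ restate G_x with the two-term
Selberg–Delange density (1:1 `--restate`); refuted structurally (an Ω-theorem: hull pairs have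
absolute level ≤ 1/2) ⇒ restate in smooth/well-factorable-moduli form (Zhang/Iwaniec bilinear shape)
or close. A bookkeeping proof that HullPairsLevel at some θ > 1/2 already implies Hardy–Littlewood
for (n, n+h) in progressions ⇒ the route is a reformulation: close `superseded`. HullPairMass
refuted (hull twins of gap h have mass o(x/log²x)) would contradict Bateman–Horn-type heuristics for
N₁₆: close `refuted:HullPairMass`. Polignac(16k) proved elsewhere moots the Target.

NOT DECOMPOSED YET. The continuous model f̃ and its monotonicity in θ (children of
TiltedSieveMainTerm); the three natural pieces of HullPairsLevel (small moduli / large-sieve range /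
beyond 1/2) and its bilinear (well-factorable) weakening, which is all the β-sieve needs
(IwaniecActaArith1980b); the z = x^{1/2−ε} variant (survivors then include p₁p₂ with p_i ∈
[x^{1/2−ε}, x^{1/2+ε}], harmless only with the strong form of HullPairMass); the general Frobenian
hull (any modulus q and subgroup H ≤ (ℤ/q)^× of index ≥ 8, e.g. p ≡ ±1 mod 17) and the card's
weighted quartic version (a = 1/2 on ℚ(ζ₅): identical sieve parameters by the a/d law); the HL-order
lower bound x/log²x (needs HullPairMass at the true order x(log x)^{−7/4}); the degree → ∞
asymptotic upgrade of the card (not claimed: as δ → 0 the hypothesis tends to HL in progressions).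

CHEAPEST FALSIFIER. (1) KIT, pure analysis, no hull pairs needed: solve the state-dependent
Buchstab/Rosser recursion for the two-colour tilted density on a grid in (s, U₁, U₂) (delay-integral
system, β = 1) and read off f̃(s; 0, 0) for s ∈ [1.02, 1.2]; f̃ ≤ 0 there kills TiltedSieveMainTerm
as filed (expected f̃(1.1) ≥ f_{1/2}(1.1) = 0.447·(1 − small)). (2) LOOKUP/BOOKKEEPING: does
Σ_{d<x^θ}|A_d − G_xX_h| ≤ X_hV(log x)^{−δ} for one θ > 1/2 formally imply HL for (n, n+h) in APs
(card's test (a))? If yes, demote. (3) NUMERICS x ≤ 10⁹, h = 16: p·A_p/X_h against 2(1 − u)^{−7/8}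
for p ≡ 1 (16) (the refuter's tilt_check.py at degree 4 matched (1−u)^{−3/4} to 2% at x = 3·10⁷; the
degree-8 run is the same script with modulus 16). Not run here: the hub is compute-free and the
planner seat is one-shot; (1) is the decisive one.

NUMBERS. Split primes p ≡ 1 (mod 16): density 1/8; hull count #N₁₆(y) ~ c·y(log y)^{−7/8} (Wirsing;
Tenenbaum2015 II.5); pair mass conjecturally ≍ x(log x)^{−7/4}; V(√x) ≍ (log x)^{−1/4}. Tilted local
pair-dimension 2δ(1−u)^{−(1−δ)}: sup over u ≤ 1/2 equals 2δ·2^{1−δ} = 0.841, 0.696, 0.594, 0.518,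
0.458, 0.373, 0.315, 0.239 for degree d = 1/δ = 4, 5, 6, 7, 8, 10, 12, 16 (threshold 1/2 first
passed at d = 8); over Buchstab states reachable with d < x^θ (prior primes ≥ current prime) the sup
stays 0.458 for θ ≤ 0.7 and exceeds 1/2 from θ ≈ 0.78 (0.522 at θ = 0.8, 0.767 at θ = 0.9) — hence
TiltedSieveMainTerm is filed on (1/2, 3/5]. β_{1/2} = 1 (tree iwaniecSiftingLimit_half; Greaves2001
§4.2.4 (4.10)); s^{1/2}f_{1/2}(s) = (e^γ/π)^{1/2}·2log(√s + √(s−1)) on [1,3]: f_{1/2}(1.05) = 0.326,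
f(1.1) = 0.447, f(1.2) = 0.596, f(1.5) = 0.810, f(2) = 0.939. Refuter numerics (degree 4, x = 3·10⁷,
#N₅ = 703560): p·A_p/#N = 1.12, 1.27, 1.39, 1.56, 1.67 at u = 0.14, 0.27, 0.35, 0.44, 0.48 vs
(1−u)^{−3/4} = 1.12, 1.26, 1.38, 1.55, 1.64. Liouville bias on N₁₆: relative ≍ (log x)^{−1/4} =
order of V (ghost excluded by exactly the (log x)^{−δ} margin of HullPairsLevel). Known levels for
PRIMES: 1/2 (BV), 1/2 + 7/300 smooth moduli (Polymath8a2014), 4/7 and 3/5 well-factorable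
(BombieriFriedlanderIwaniecActa1986, Maynard2020LargeModuliII). Items at open: 6.

DEFINITION REQUESTS. None needed to open (hull, A_d, T_x, G_x are inlined by `let`). If the route
gains traction: `Literature/NumberTheory/Sieve`: notion FrobenianHull (q, H ≤ (ℤ/q)^×) with its
Wirsing asymptotic as a cite fact (Tenenbaum2015 II.5 / Wirsing 1961), and notion TiltedPairDensity
(the G_x above) so that HullPairsLevel and TiltedSieveMainTerm shorten; cite fact wanted: Indlekofer
1974 B-twin lower bound (doi:10.4064/aa-26-2-207-212) as the κ = 1 comparator.

Novelty: Searches (2026-08-15): `lit search --hybrid "half dimensional sieve prime pairs sifted set primes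
congruent 1 mod"` (12 held docs: Greaves, Hooley, Friedlander–Heath-Brown–Iwaniec–Kaczorowski
lectures, Harman; no hull-pair sieve); `lit vsearch "sieve with density depending on log d/log x,
variable dimension Buchstab"` (Greaves pp. 229–230 vector sieve = nearest, READ); `lit search
--source zbmath "B-Zwillinge"` (5: Indlekofer–Schwarz 1972 doi:10.1007/bf01304878, Indlekofer 1974
doi:10.4064/aa-26-2-207-212, Bantle 1985/1986); `lit search --source zbmath "correlations of sums of
two squares"` (Bary-Soroker–Fehm arXiv:1701.04092, Matthiesen arXiv:1106.4690, arXiv:1205.4145);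
`lit galaxy search "all of whose prime factors are congruent to 1" --star all` (1 hit, Buell's BQF
book); `lit frontier Parity --since 2021` (30 rows; Banks–Ford arXiv:2605.01155 on random BH sets,
tangential); `lit bridges Parity --cross any` (nothing bearing); `ledger negatives --problem Parity`
(0); tree search: RosserSieve*/BetaSieve.pred/lowerSum_le_sifted/half_dimensional_sieve_lower_holds
located; arXiv and OpenAlex APIs rate-limited this session (logged). The card's own searches
(Iwaniec 1972/1976/1980, Loughran–Matthiesen arXiv:1904.12845, Opera de Cribro ch. 11/14) are
inherited.
Nearest prior art found: Iwaniec 1976 "The half dimensional sieve" (doi:10.4064/aa-29-1-69-95) and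
Iwaniec 1972 (shifted primes p = φ(x,y)+A: half-dimensional sieve with PRIMES as input and a norm
condition as output); Ind  [refs: 10.1007/bf01304878, 10.4064/aa-26-2-207-212, 10.4064/aa-29-1-69-95, 10.4064/aa-26-2-207-212:, 1701.04092, 1106.4690, 1205.4145, 2605.01155, 1904.12845, doi:10.1007/bf01304878, doi:10.4064/aa-26-2-207-212, doi:10.4064/aa-29-1-69-95, Greaves2001]

Barriers (technique_class: half-dimensional-sieve level-of-distribution): - technique_class: half-dimensional-sieve level-of-distribution
- Literature.Barriers.Parity.SelbergParityBarrier: evaded at the prime-producing step only — the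
residual sieve has one-sided dimension ≤ 0.458 < 1, sifting limit 1 < 2θ, so Selberg's Type-I
indistinguishability of a_n and a_n(1 ± λ) does not bite on the sieve step; the ghost b·(1 −
λ(n)λ(n+h)) on hull pairs violates HullPairsLevel by exactly the (log x)^{−δ} margin (λ-bias ≍ (log
x)^{−1/4} = V on N₁₆); globally the parity content sits in HullPairsLevel's precision and in
HullPairMass — relocated, not removed, and said so.
- Literature.Barriers.Parity.LinearSieveOptimality: consistent — it is the reason degrees ≤ 7
(tilted sup ≥ 0.518 > 1/2, and degree 2 with κ = 1, limit 2) are not used; at δ = 1/8 the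
linear-sieve limit is not the operative one.
- Literature.Barriers.Parity.LargeSieveLevelHalf: it does not evade; HullPairsLevel asks absolute
level θ > 1/2 for a pair sequence. The bet: ANY θ > 1/2 suffices (f_{1/2}(2θ) > 0), the Rosser
moduli are flexibly factorable (IwaniecActaArith1980b), and level beyond 1/2 IS known for primes in
exactly such shapes (Zhang/Polymath8a smooth moduli in absolute value; BFI/Maynard well-factorable)
— the dispersion method, not the large sieve, is the intended engine for the increment (1/2, 1/2+δ].
- Literature.Barriers.Parity.PrimePairParity: consistent — the inputs are not Type-I/Type-II data of
the prime indicator or of {p+h}; HullPairsLevel is a distribution statement about a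

History (route lifecycle, newest last):
- 2026-08-15T13:49:44Z · CLOSED retired — not-a-thesis: assembly does not conclude the sub-problem Statement (operator:999:1257524)

sub-problem: GeneralizedHardyLittlewood · status: closed(retired) · opened planner-plancard-Parity-GeneralizedHardyLittl-d0f3a14a-0 2026-08-15T12:25:55Z · rev 1 · ledger route-Parity-HullDescent
GENERATED by the gate from the ledger (D-0016/17). Provers cite these decls: `theorem foo : Summit.Parity.GeneralizedHardyLittlewood.Theses.HullDescent.<Decl> := …` in Summits/Parity/GeneralizedHardyLittlewood/Theorems/<Name>.lean.
-/

namespace Summit.Parity.GeneralizedHardyLittlewood.Theses.HullDescent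

open scoped BigOperators Topology Manifold Classical MeasureTheory ProbabilityTheory Matrix InnerProductSpace ComplexConjugate ContinuousMap
open Filter Set Function TopologicalSpace MeasureTheory

attribute [summit_statement] _root_.GeneralizedHardyLittlewood

/-- item stmt-Parity-8043 · target · rank 0 · closed · moot by None · by planner
why it might fail: it is an instance of the prime-pair conjecture (infinite complexity); every known method meets the parity barrier; here it inherits HullPairsLevel and HullPairMass.
sources: Polymath8b2014, Bombieri1976, ZhangAnnals2014, Maynard2015
[target] for every h ≠ 0 with 16 ∣ h and no prime factor ≡ 1 (mod 16) there are infinitely many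
primes p ≡ 1 (mod 16) such that p + h is prime (de Polignac for the gaps 16k, k free of primes ≡ 1
mod 16; the conclusion of the Assembly, implied by but not implying GHL). -/
@[route_item "route-Parity-HullDescent"]
def PolignacInHullClass : Prop :=
  ∀ h : ℕ, h ≠ 0 → 16 ∣ h → (∀ p ∈ h.primeFactors, p % 16 ≠ 1) → ∃ᶠ p : ℕ in Filter.atTop, p.Prime ∧ p % 16 = 1 ∧ (p + h).Prime

/-- item stmt-Parity-8044 · crux · rank 2 · closed · moot by None · by planner
why it might fail: Absolute level > 1/2 for a binary (hull-pair) sequence is EH-type (LargeSieveLevelHalf); even the d ≤ (log x)^A part needs hull pairs equidistributed to (log x)^{-1/4-δ}, an open binary problem; an unmodelled secondary term of relative size ≥ (log x)^{-1/4} in A_d/X_h falsifies G as typed.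
sources: BombieriFriedlanderIwaniecActa1986, ZhangAnnals2014, Polymath8a2014, arXiv:1701.04092, arXiv:1904.12845, Literature.Barriers.Parity.LargeSieveLevelHalf
[crux] (card C2, repaired) LEVEL 1/2+δ FOR HULL PAIRS WITH THE TILTED MODEL. For every admissible h
there are θ ∈ (1/2, 1), δ > 0 and local factors η (|η_p| ≤ C/p, |η_p| ≤ 1/2) such that eventually
Σ_{d ∣ P(√x), d ≤ x^θ} |A_d(x) − G_x(d)·X_h(x)| ≤ X_h(x)·(log x)^{−1/4−δ}, where A_d(x) = #{n ≤ x :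
d ∣ n(n+h), n, n+h ∈ N₁₆}, X_h = A_1, G_x(d) = 1[d squarefree, all p ∣ d ≡ 1
(16)]·(Π_{p∣d}(1+η_p)/d)·Σ_{e∣d} T_x(e)T_x(d/e), T_x(e) = (1 − log e/log x)^{−7/8}. (V(√x) ≍ (log
x)^{−1/4}, so this is Iwaniec's R(𝒜, x^θ) ≤ XV(log x)^{−δ} with the correct x-dependent main terms;
leading-order model error is O(log log x/log x) ≪ (log x)^{−1/4}, checked.) [difficulty:
open-problem] -/
@[route_item "route-Parity-HullDescent"]
def HullPairsLevel : Prop :=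
  let hull : ℕ → Prop := fun n => ∀ p ∈ n.primeFactors, p % 16 = 1; let A : ℕ → ℝ → ℕ → ℝ := fun h x d => (((Finset.Icc 1 ⌊x⌋₊).filter (fun n => d ∣ n * (n + h) ∧ hull n ∧ hull (n + h))).card : ℝ); let T : ℝ → ℕ → ℝ := fun x e => (1 - Real.log (e : ℝ) / Real.log x) ^ (-(7 / 8 : ℝ)); let G : (ℕ → ℝ) → ℝ → ℕ → ℝ := fun η x d => if Squarefree d ∧ (∀ p ∈ d.primeFactors, p % 16 = 1) then (∏ p ∈ d.primeFactors, (1 + η p)) / (d : ℝ) * ∑ e ∈ d.divisors, T x e * T x (d / e) else 0; ∀ h : ℕ, h ≠ 0 → 16 ∣ h → (∀ p ∈ h.primeFactors, p % 16 ≠ 1) → ∃ θ : ℝ, 1 / 2 < θ ∧ θ < 1 ∧ ∃ δ : ℝ, 0 < δ ∧ ∃ C : ℝ, ∃ η : ℕ → ℝ, (∀ p : ℕ, |η p| ≤ C / p ∧ |η p| ≤ 1 / 2) ∧ ∀ᶠ x : ℝ in Filter.atTop, ∑ d ∈ (Literature.NumberTheory.Sieve.primesProdBelow (Real.sqrt x)).divisors.filter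 (fun d : ℕ => (d : ℝ) ≤ x ^ θ), |A h x d - G η x d * A h x 1| ≤ A h x 1 * (Real.log x) ^ (-(1 / 4 : ℝ) - δ)

/-- item stmt-Parity-8045 · crux · rank 3 · closed · moot by None · by planner
why it might fail: G_x is non-multiplicative (T(e)T(f) couples the prime factors of d through colour sums); if the state-dependent Buchstab recursion has sifting limit > 1 despite local dimension ≤ 0.458, the β=1 main term is ≤ 0 at s = 2θ ≤ 6/5 and no θ < 1 near 1/2 works.
sources: IwaniecActaArith1980, doi:10.4064/aa-29-1-69-95, Greaves2001, FriedlanderIwaniecOpera2010, HalberstamRichert1974, Literature.NumberTheory.Sieve.SieveSequence.half_dimensional_sieve_lower_holds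
[crux] (card C4's sieve step, made honest) THE β = 1 ROSSER LOWER SIEVE HAS A POSITIVE MAIN TERM FOR
THE TILTED TWO-COLOUR DENSITY at level x^θ, sifting range √x, for every θ ∈ (1/2, 3/5] and every
admissible local-factor perturbation η: Σ_{d ∣ P(√x)} μ(d)·χ⁻_{β=1, D=x^θ}(d)·G_x(d) ≥ c(θ, C,
η)·(log x)^{−1/4} eventually (χ⁻ = tree `BetaSieve.ind 0 1 (x^θ)`; G_x as in HullPairsLevel; s = 2θ
∈ (1, 6/5]). Expected route: re-run Iwaniec 1980 §§4, 8–9 (tree RosserSieveSums,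
RosserSieveMainTerm) with the state-dependent density (1/8)[(1−u/(1−U₁))^{−7/8} +
(1−u/(1−U₂))^{−7/8}], whose supremum over reachable states is 0.458 < 1/2 for θ ≤ 0.7, so the
one-sided Ω(1/2, L) comparison of Lemma 21 applies state by state and the main term is ≥
V(√x)(f_{1/2}(2θ) − o(1)), f_{1/2}(1.1) = 0.447. [difficulty: L] -/
@[route_item "route-Parity-HullDescent"]
def TiltedSieveMainTerm : Prop :=
  let T : ℝ → ℕ → ℝ := fun x e => (1 - Real.log (e : ℝ) / Real.log x) ^ (-(7 / 8 : ℝ)); let G : (ℕ → ℝ) → ℝ → ℕ → ℝ := fun η x d => if Squarefree d ∧ (∀ p ∈ d.primeFactors, p % 16 = 1) then (∏ p ∈ d.primeFactors, (1 + η p)) / (d : ℝ) * ∑ e ∈ d.divisors, T x e * T x (d / e) else 0; ∀ θ : ℝ, 1 / 2 < θ → θ ≤ 3 / 5 → ∀ C : ℝ, ∀ η : ℕ → ℝ, (∀ p : ℕ, |η p| ≤ C / p ∧ |η p| ≤ 1 / 2) → ∃ c : ℝ, 0 < c ∧ ∀ᶠ x : ℝ in Filter.atTop, c * (Real.log x)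 ^ (-(1 / 4 : ℝ)) ≤ ∑ d ∈ (Literature.NumberTheory.Sieve.primesProdBelow (Real.sqrt x)).divisors, (ArithmeticFunction.moebius d : ℝ) * Literature.NumberTheory.Sieve.BetaSieve.ind 0 1 (x ^ θ) d * G η x d

/-- item stmt-Parity-8046 · crux · rank 4 · closed · moot by None · by planner
why it might fail: Open binary lower bound: sifting n(n+h) by the non-split primes (density 7/8, κ = 7/4) at s = 2 is below the sifting limit β_{7/4} ≈ 4; the B-twin analogue (κ = 1, s = 2 = β_1) needed the r(n)-structure of sums of two squares (Indlekofer 1974).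
sources: doi:10.4064/aa-26-2-207-212, doi:10.1007/bf01304878, Tenenbaum2015, Greaves2001, arXiv:1701.04092
[crux] (card C1, weak form) HULL TWINS HAVE AT LEAST MASS x/(log x)²: for every admissible h,
eventually #{n ≤ x : n, n+h ∈ N₁₆} ≥ x/(log x)² (conjectured truth 𝔖_N(h)c²x(log x)^{−7/4}; any
bound ≫ x(log x)^{−2} suffices for the Assembly, the HL-order lower bound x/log²x for prime pairs
needs the true order). [difficulty: open-problem] -/
@[route_item "route-Parity-HullDescent"]
def HullPairMass : Prop :=
  let hull : ℕ → Prop := fun n => ∀ p ∈ n.primeFactors, p % 16 = 1; let A : ℕ → ℝ → ℕ → ℝ := fun h x d => (((Finset.Icc 1 ⌊x⌋₊).filter (fun n => d ∣ n * (n + h) ∧ hull n ∧ hull (n + h))).card : ℝ); ∀ h : ℕ, h ≠ 0 → 16 ∣ h → (∀ p ∈ h.primeFactors, p % 16 ≠ 1) → ∀ᶠ x : ℝ in Filter.atTop, x / (Real.log x) ^ 2 ≤ A h x 1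

/-- item stmt-Parity-8047 · support · rank 9 · closed · moot by None · by planner
sources: Greaves2001, IwaniecActaArith1980, Literature.NumberTheory.Sieve.SieveSequence.lowerSum_le_sifted
[support] ROSSER'S INEQUALITY + SURVIVORS ARE PRIME PAIRS (provable now): for admissible h, θ ∈
(1/2, 1) there is C = C(h) with, for all x ≥ 2, Σ_{d ∣ P(√x)} μ(d)χ⁻_{1,x^θ}(d)A_d(x) ≤ #{p ≤ x : p
prime, p ≡ 1 (16), p+h prime} + C. Proof: tree `SieveSequence.lowerSum_le_sifted` (applied to a_m =
#{n ≤ x : n(n+h) = m, n, n+h ∈ N₁₆}) bounds the left side by the survivors S = #{n ≤ x : n, n+h ∈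
N₁₆, (n(n+h), P(√x)) = 1}; a hull number ≤ x free of primes < √x is 1, a prime ≥ √x, or x = p²
itself; n+h ≤ x+h free of primes < √x is prime unless n > x − h; so S ≤ #{prime pairs} + h + 3.
[difficulty: provable-now] -/
@[route_item "route-Parity-HullDescent"]
def RosserToPrimePairs : Prop :=
  let hull : ℕ → Prop := fun n => ∀ p ∈ n.primeFactors, p % 16 = 1; let A : ℕ → ℝ → ℕ → ℝ := fun h x d => (((Finset.Icc 1 ⌊x⌋₊).filter (fun n => d ∣ n * (n + h) ∧ hull n ∧ hull (n + h))).card : ℝ); ∀ h : ℕ, h ≠ 0 → 16 ∣ h → (∀ p ∈ h.primeFactors, p % 16 ≠ 1) → ∀ θ : ℝ, 1 / 2 < θ → θ < 1 → ∃ C : ℝ, ∀ x : ℝ, 2 ≤ x → ∑ d ∈ (Literature.NumberTheory.Sieve.primesProdBelow (Real.sqrt x)).divisors, (ArithmeticFunction.moebius d : ℝ) * Literature.NumberTheory.Sieve.BetaSieve.ind 0 1 (x ^ θ) d * A h x d ≤ (((Finset.Icc 1 ⌊x⌋₊).filter (fun p => p.Prime ∧ p % 16 = 1 ∧ (p + h).Prime)).card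 : ℝ) + C

/-- item stmt-Parity-8048 · assembly · rank 1 · closed · moot by None · by planner
sources: IwaniecActaArith1980, Greaves2001
[assembly] HullPairsLevel → TiltedSieveMainTerm → HullPairMass → RosserToPrimePairs →
PolignacInHullClass. -/
@[route_item "route-Parity-HullDescent"]
def Assembly : Prop :=
  HullPairsLevel → TiltedSieveMainTerm → HullPairMass → RosserToPrimePairs → PolignacInHullClass

end Summit.Parity.GeneralizedHardyLittlewood.Theses.HullDescent
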